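import Literature.IUT.LogThetaLattice.GlobalLGPFrobenioidsRealifiedModel
import Literature.IUT.LogThetaLattice.GlobalFrobenioidModelsFrobenioid
import Literature.AlgebraicGeometry.Frobenioids.PadicFrobenioidIsFrobenioid
import HarnessLib

/-!
# [IUTchIII] Proposition 3.7 (ii)/(iii) «(†𝓕⊛ℝ_𝔪𝔬𝔡)_α», C: the realification IS the [FrdI] model Frobenioid of
# `(Φ^rlf, ℝ · Φ^birat)` over the one-arrow base, and IS A FROBENIOID ([FrdI] Def. 1.3) of isotropic type

abc-iut cell, layer L6, wave-5 seat abc-iut-w5-d153 (gen 2); part C of the lineage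
`GlobalLGPFrobenioidsRealifiedRatFn.lean` (A: `ℝ · Φ^birat = Prop37.realRatFn`) /
`GlobalLGPFrobenioidsRealifiedModel.lean` (B: the category `Prop37.FrakRlfCat F = (†𝓕⊛ℝ_𝔪𝔬𝔡)_α`, the functor
`Prop37.realification`), closing the junction named NOT DONE in B's header: "identification with layer L1's
abstract `PreFrobenioid.realification` (`RealificationData.realSpan`, `RlfModelOf`) over the one-morphism base" —
at the level the tree can state today (see RESIDUAL).

PRINT. [IUTchIII] Prop. 3.7 (ii) p. 110 l. 48–49 "Write `(†𝓕⊛ℝ_𝔪𝔬𝔡)_α` for the realification of `(†𝓕⊛_𝔪𝔬𝔡)_α`";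
(iii) p. 110 l. 69–90 "one obtains a functorial algorithm … to construct a [global realified] Frobenioid
`†𝒞^⊩_LGP`" (isomorphic to one copy of the realification: [IUTchII] Cor. 4.5 (v), abc-iut-L6-t4's `Prop37.embDiag`)
[claim key Mochizuki2012, status disputed (D-0012)]. [FrdI] Prop. 5.3 p. 103: "we shall refer to as the
realification `C^rlf` of the Frobenioid `C` the model Frobenioid [cf. Theorem 5.2, (ii)] associated to the divisor
monoid `Φ^rlf` … and the rational function monoid `ℝ · Φ^birat ⊆ (Φ^rlf)^gp` [i.e., … the `ℝ`-vector subspace of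
`(Φ^rlf)^gp(A_𝒟)` generated by `Φ^birat(A_𝒟)`]"; Thm. 5.2 (ii) p. 101: "`C` [the model Frobenioid of a divisorial
`Φ` and a group-like `𝔹` over a connected, totally epimorphic `𝒟`] is a Frobenioid of isotropic type"; Prop. 5.5
(iv) p. 104 l. 40–44 (for a model Frobenioid with `Φ^birat =` image of `Div_𝔹`, `C^rlf` is the model Frobenioid of
`(Φ^rlf, ℝ · Φ^birat)`) [cite: MochizukiFrdI2008, Prop. 5.3 p.103] [cite: MochizukiFrdI2008, Thm. 5.2 (ii) p.101]
[cite: MochizukiFrdI2008, Prop. 5.5 (iv) p.104].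

CONTENTS (template: abc-iut-L6-t6's `GlobalFrobenioidModelsData.lean` / `GlobalFrobenioidModelsFrobenioid.lean`,
which do the same for `(†𝓕⊛_𝔪𝔬𝔡)_α = FrakCat`):
* the [FrdI] Thm. 5.2 DATA of the realification over the one-arrow base `𝒟` (`GlobalFrobenioidModels.Base`):
  `Φ^rlf := Φmod (ModelPlaces F) ℝ ℝ_{≥0}` (effective real families; divisorial by abc-iut-L6-t6's
  `isDivisorial_effDiv` at abc-iut-L6-d1's `modelHyps_places`), `𝔹^rlf := ℝ · Φ^birat` (`FrakRlfCat.BRlf`, the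
  group `Prop37.realRatFn F` written multiplicatively, constant on `𝒟`), `Div_𝔹 :=` the inclusion
  `ℝ · Φ^birat ↪ (Φ^rlf)^gp` (`FrakRlfCat.divBRlf`);
* `FrakRlfCat.realRatFn_eq_closure` — `ℝ · Φ^birat` IS the subgroup generated by the `r • Div(f)` (the shape of
  layer L1's `RealificationData.realSpan`: generated by the `r • ι(c)`, `c ∈ Φ^birat`; here `Φ^birat =` the
  principal families, the image of `Div_𝔹` of `(†𝓕⊛_𝔪𝔬𝔡)_α` — [FrdI] Thm. 5.2 preamble / abc-iut-L1-d2's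
  `ModelFrobenioid.biratSubfunctor_eq_ofModelData`);
* **`FrakRlfCat.toModel : FrakRlfCat F ⥤ ModelFrobenioid Φ^rlf 𝔹^rlf Div_𝔹`**, `𝔍 ↦ (∗, −[𝔍])`,
  `(n, u) ↦ (n, id, u + n•𝔍₁ − 𝔍₂, u)`, PROVED full, faithful, essentially surjective, hence an EQUIVALENCE:
  `(†𝓕⊛ℝ_𝔪𝔬𝔡)_α ≌` "the model Frobenioid associated to the divisor monoid `Φ^rlf` and the rational function monoid
  `ℝ · Φ^birat`" — [FrdI] Prop. 5.3 verbatim at the model of record, in the tree's [FrdI] Thm. 5.2 vocabulary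
  (abc-iut-found's `ModelFrobenioid`);
* `FrakRlfCat.structureFunctor := toModel ⋙ ModelFrobenioid.toElem : (†𝓕⊛ℝ_𝔪𝔬𝔡)_α → F_{Φ^rlf}` and
  **`FrakRlfCat.isFrobenioid`**: the realification IS A FROBENIOID in the sense of [FrdI] Def. 1.3 (i)–(vii)
  (abc-iut-found's `PreFrobenioid.IsFrobenioid`, via [FrdI] Thm. 5.2 (ii) `ModelFrobenioid.isFrobenioid` transported
  along the equivalence), of isotropic type (`isOfIsotropicType`), a pre-Frobenioid; base = the one-arrow category,
  `deg_Fr(n, u) = n`, `Div(n, u) = u + n•𝔍₁ − 𝔍₂`, linear iff `n = 1`.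

RESIDUAL (named, NOT done here; layer-L1-sized, the [FrdI] Thm. 6.4 (i) "`(Φ^rlf)^gp(L) = ⊕_v ℝ`" programme of
the abc-iut-L1-d2 / abc-iut-L6-t10 lineage): the identification of THE canonical realification
`(RealificationData.canonical Φ _).rlf` (= `IsPerfFactorial.Rlf` of the INTEGRAL divisor monoid of
`(†𝓕⊛_𝔪𝔬𝔡)_α = Ffrak F`, primes `≃` places) with `Φ^rlf = Φmod (ModelPlaces F) ℝ ℝ_{≥0}` along abc-iut-w4-d005's
`realifyObjHom`. Granting it, `toModel` ∘ abc-iut-L1-d2's `ModelFrobenioid.prop55iv_rlf_holds` ∘ abc-iut-L6-t6's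
`GlobalFrobenioidModels.toModel` is the equivalence `PreFrobenioid.realification (structureFunctor _) (canonical …) ≌
FrakRlfCat F` (junction J1 in full). No `Prop`-valued definition; nothing here asserts a disputed claim or takes a
side on [IUTchIII] Cor. 3.12; typed ≠ discharged; instantiated ≠ endorsed.
-/

noncomputable section

namespace Literature.IUT.LogThetaLattice

namespace Prop37

namespace FrakRlfCat

open CategoryTheory Opposite NumberField GlobalFrobenioidModels Literature.AlgebraicGeometry.Frobenioids

variable (F : Type) [Field F] [NumberField F]

/-! ### The data `(𝒟, Φ^rlf, 𝔹^rlf = ℝ · Φ^birat, Div_𝔹)` of [FrdI] Thm. 5.2 for the realification -/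

/-- `Φ^rlf`: the divisor monoid of the realification — effective REAL families `{D_v ∈ ℝ_{≥0}}_v` at the model
places, constant on the one-arrow base ([FrdI] Prop. 5.3: "the divisor monoid `Φ^rlf` [i.e., the 'realification' of
Definition 2.4, (i)]"; at the model of record abc-iut-L6-d1/d3 take `Γ_v = ℝ` at every place).
[cite: MochizukiFrdI2008, Prop. 5.3 p.103] -/
abbrev PhiRlf : Base.{0}ᵒᵖ ⥤ CommMonCat.{0} := Φmod (ModelPlaces F) (fun _ => ℝ) nonnegModel

/-- `𝔹^rlf := ℝ · Φ^birat`, the rational function monoid of the realification (part A's `Prop37.realRatFn`, written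
multiplicatively), constant on the one-arrow base. [cite: MochizukiFrdI2008, Prop. 5.3 p.103] -/
abbrev BRlf : Base.{0}ᵒᵖ ⥤ CommMonCat.{0} := constMonoidOn (Multiplicative (realRatFn F))

/-- `ℝ · Φ^birat ↪ (Φ^rlf)^gp` as a homomorphism of groups: a real rational function IS a class in
`(Φ^rlf)^gp = ⊕'_v ℝ` (abc-iut-L6-t6's `toGp` reads a family as an element of the groupification).
[cite: MochizukiFrdI2008, Prop. 5.3 p.103] -/
def divBRlfHom :
    Multiplicative (realRatFn F) →* Algebra.GrothendieckGroup (EffDiv (ModelPlaces F) (fun _ => ℝ) nonnegModel) :=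
  (toGp (modelHyps_places F)).comp (AddMonoidHom.toMultiplicative (realRatFn F).subtype)

/-- `divBRlfHom` on an element: the class of the underlying family. [cite: MochizukiFrdI2008, Prop. 5.3 p.103] -/
theorem divBRlfHom_apply (u : Multiplicative (realRatFn F)) :
    divBRlfHom F u =
      toGp (modelHyps_places F) (Multiplicative.ofAdd ((Multiplicative.toAdd u : realRatFn F) : ModelFrakObj F)) :=
  rfl

/-- `Div_𝔹 : ℝ · Φ^birat ↪ (Φ^rlf)^gp` as a homomorphism of monoids on the one-arrow base ([FrdI] Prop. 5.5 (iv):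
the data "`Φ^rlf, ℝ · Φ^birat, ℝ · Φ^birat ↪ (Φ^rlf)^gp`"). [cite: MochizukiFrdI2008, Prop. 5.5 (iv) p.104] -/
def divBRlf : BRlf F ⟶ monoidGp (PhiRlf F) where
  app _ := CommMonCat.ofHom (divBRlfHom F)
  naturality X Y f := by
    apply CommMonCat.hom_ext
    refine MonoidHom.ext fun u => ?_
    change divBRlfHom F u = MonGp.map (MonoidHom.id _) (divBRlfHom F u)
    rw [MonGp.map_id]
    rfl

/-- `Div_𝔹` at the unique object is `divBRlfHom`. [cite: MochizukiFrdI2008, Prop. 5.5 (iv) p.104] -/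
theorem divB_divBRlf (u : Multiplicative (realRatFn F)) :
    divB (PhiRlf F) (BRlf F) (divBRlf F) (op pt) u = divBRlfHom F u := rfl

/-- `𝔹^rlf = ℝ · Φ^birat` is (objectwise) GROUP-LIKE ([FrdI] Def. 1.1 (i)) — it is a group.
[cite: MochizukiFrdI2008, Thm. 5.2 (ii) p.101] -/
theorem objectwise_isGroupLike_BRlf : Objectwise (fun M _ => IsGroupLike M) (BRlf F) :=
  fun _ => isGroupLike_of_forall_isUnit fun b : Multiplicative (realRatFn F) => Group.isUnit b

/-- **`ℝ · Φ^birat` is the subgroup of `(Φ^rlf)^gp` GENERATED by the `r • Div(f)`** (`r ∈ ℝ`, `f ∈ F^×_mod`) — the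
shape of layer L1's `RealificationData.realSpan Φ^birat` ("the `ℝ`-vector subspace of `(Φ^rlf)^gp(A_𝒟)` generated by
`Φ^birat(A_𝒟)`", [FrdI] Prop. 5.3), with `Φ^birat(∗) =` the principal families `Div(f)` (= the image of `Div_𝔹` of
`(†𝓕⊛_𝔪𝔬𝔡)_α`, [FrdI] Thm. 5.2 preamble). Both inclusions: part A's `realRatFn_le` and
`rscale_prinFamily_mem_realRatFn`. [cite: MochizukiFrdI2008, Prop. 5.3 p.103] -/
theorem realRatFn_eq_closure :
    realRatFn F = AddSubgroup.closure {u : ModelFrakObj F | ∃ (r : ℝ) (f : Fˣ), u = rscale F r (prinFamily F f)} := by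
  refine le_antisymm (realRatFn_le F _ fun r f => AddSubgroup.subset_closure ⟨r, f, rfl⟩) ?_
  rw [AddSubgroup.closure_le]
  rintro _ ⟨r, f, rfl⟩
  exact rscale_prinFamily_mem_realRatFn F r f

/-! ### The model Frobenioid of `(Φ^rlf, ℝ · Φ^birat)` and the comparison functor -/

/-- "The model Frobenioid associated to the divisor monoid `Φ^rlf` and the rational function monoid `ℝ · Φ^birat`"
([FrdI] Prop. 5.3 p. 103 — by definition the realification `C^rlf`), in abc-iut-found's [FrdI] Thm. 5.2 (i)
vocabulary, for `C = (†𝓕⊛_𝔪𝔬𝔡)_α` at the model of record. [cite: MochizukiFrdI2008, Prop. 5.3 p.103] -/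
abbrev RlfModel : Type := ModelFrobenioid (PhiRlf F) (BRlf F) (divBRlf F)

variable {F}

/-- The zero divisor `Div(n, u) = u + n•𝔍₁ − 𝔍₂ ∈ Φ^rlf` of a morphism of `(†𝓕⊛ℝ_𝔪𝔬𝔡)_α` as an effective family.
[cite: MochizukiFrdI2008, Thm. 5.2 (i) p.100] -/
def homDiv {X Y : FrakRlfCat F} (φ : X ⟶ Y) : EffDiv (ModelPlaces F) (fun _ => ℝ) nonnegModel :=
  Multiplicative.ofAdd ⟨fn φ + (deg φ : ℕ) • X.obj - Y.obj, eff_mem φ⟩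

/-- The family underlying `homDiv φ`. [cite: MochizukiFrdI2008, Thm. 5.2 (i) p.100] -/
theorem coe_homDiv {X Y : FrakRlfCat F} (φ : X ⟶ Y) :
    ((Multiplicative.toAdd (homDiv φ) : effDiv (ModelPlaces F) (fun _ => ℝ) nonnegModel) : ModelFrakObj F) =
      fn φ + (deg φ : ℕ) • X.obj - Y.obj := rfl

/-- The rational function `u ∈ ℝ · Φ^birat` of a morphism, as an element of `𝔹^rlf(∗)`.
[cite: MochizukiFrdI2008, Thm. 5.2 (i) p.100] -/
def homUnit {X Y : FrakRlfCat F} (φ : X ⟶ Y) : Multiplicative (realRatFn F) :=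
  Multiplicative.ofAdd ⟨fn φ, fn_mem φ⟩

/-- The family underlying `homUnit φ` is `fn φ`. [cite: MochizukiFrdI2008, Thm. 5.2 (i) p.100] -/
@[simp] theorem coe_toAdd_homUnit {X Y : FrakRlfCat F} (φ : X ⟶ Y) :
    ((Multiplicative.toAdd (homUnit φ) : realRatFn F) : ModelFrakObj F) = fn φ := rfl

variable (F) in
/-- The class `−[𝔍] ∈ (Φ^rlf)^gp` of an object of `(†𝓕⊛ℝ_𝔪𝔬𝔡)_α` (sign as in abc-iut-L6-t6's `objCls`: with it the
relation `n·α + Div(φ) = β + Div_𝔹(u)` of [FrdI] Thm. 5.2 (i) is the effectivity of `u + n•𝔍₁ − 𝔍₂`).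
[cite: MochizukiFrdI2008, Thm. 5.2 (i) p.100] -/
def objCls (X : FrakRlfCat F) : Algebra.GrothendieckGroup (EffDiv (ModelPlaces F) (fun _ => ℝ) nonnegModel) :=
  toGp (modelHyps_places F) (Multiplicative.ofAdd (-X.obj))

/-- `[Div(φ)] ∈ (Φ^rlf)^gp` is the class of the family `u + n•𝔍₁ − 𝔍₂`. [cite: MochizukiFrdI2008, Thm. 5.2 (i) p.100] -/
theorem of_homDiv {X Y : FrakRlfCat F} (φ : X ⟶ Y) :
    Algebra.GrothendieckGroup.of (homDiv φ) =
      toGp (modelHyps_places F) (Multiplicative.ofAdd (fn φ + (deg φ : ℕ) • X.obj - Y.obj)) := by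
  rw [toGp_ofAdd, toGpFun_of_mem (modelHyps_places F) (eff_mem φ)]
  rfl

variable (F) in
/-- **The comparison functor `(†𝓕⊛ℝ_𝔪𝔬𝔡)_α ⥤ ModelFrobenioid(𝒟, Φ^rlf, ℝ · Φ^birat)`**: `𝔍 ↦ (∗, −[𝔍])`,
`(n, u) ↦ (n, id, u + n•𝔍₁ − 𝔍₂, u)`; relation (d) of [FrdI] Thm. 5.2 (i) is the identity
`−n•𝔍₁ + (u + n•𝔍₁ − 𝔍₂) = −𝔍₂ + u`. [cite: MochizukiFrdI2008, Prop. 5.3 p.103] -/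
def toModel : FrakRlfCat F ⥤ RlfModel F where
  obj X := ⟨pt, objCls F X⟩
  map {X Y} φ :=
    { degFr := deg φ
      base := 𝟙 _
      div := homDiv φ
      unit := homUnit φ
      rel := by
        rw [pullGp_id, divB_divBRlf]
        show objCls F X ^ (deg φ : ℕ) * Algebra.GrothendieckGroup.of (homDiv φ) =
          objCls F Y * divBRlfHom F (homUnit φ)
        rw [of_homDiv, divBRlfHom_apply, coe_toAdd_homUnit]
        unfold objCls
        rw [← map_pow, ← map_mul, ← map_mul]
        congr 1
        apply Multiplicative.toAdd.injective
        simp only [toAdd_mul, toAdd_pow, toAdd_ofAdd, smul_neg]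
        abel }
  map_id X := by
    refine ModelFrobenioid.Hom.ext rfl rfl ?_ ?_
    · show homDiv (𝟙 X) = 1
      apply Multiplicative.toAdd.injective
      apply Subtype.ext
      rw [coe_homDiv]
      show fn (𝟙 X) + ((deg (𝟙 X) : ℕ+) : ℕ) • X.obj - X.obj = (0 : ModelFrakObj F)
      rw [fn_id, deg_id, PNat.one_coe, one_nsmul, zero_add, sub_self]
    · show homUnit (𝟙 X) = 1
      apply Multiplicative.toAdd.injective
      apply Subtype.ext
      rw [coe_toAdd_homUnit, fn_id]
      rfl
  map_comp {X Y Z} φ ψ := by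
    refine ModelFrobenioid.Hom.ext rfl (Subsingleton.elim _ _) ?_ ?_
    · show homDiv (φ ≫ ψ) = homDiv ψ * homDiv φ ^ (deg ψ : ℕ)
      apply Multiplicative.toAdd.injective
      apply Subtype.ext
      simp only [toAdd_mul, toAdd_pow, AddSubmonoid.coe_add, AddSubmonoidClass.coe_nsmul, coe_homDiv, fn_comp,
        deg_comp, PNat.mul_coe]
      rw [← comp_eff_identity]
    · show homUnit (φ ≫ ψ) = homUnit ψ * homUnit φ ^ (deg ψ : ℕ)
      apply Multiplicative.toAdd.injective
      apply Subtype.ext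
      simp only [toAdd_mul, toAdd_pow, AddSubgroup.coe_add, AddSubgroupClass.coe_nsmul, coe_toAdd_homUnit,
        fn_comp]

/-- `toModel` on objects: base `∗`. [cite: MochizukiFrdI2008, Prop. 5.3 p.103] -/
@[simp] theorem toModel_obj_base (X : FrakRlfCat F) : ((toModel F).obj X).base = pt := rfl

/-- `toModel` on objects: the class `−[𝔍]`. [cite: MochizukiFrdI2008, Prop. 5.3 p.103] -/
theorem toModel_obj_cls (X : FrakRlfCat F) : ((toModel F).obj X).cls = objCls F X := rfl

/-- `toModel` preserves the Frobenius degree. [cite: MochizukiFrdI2008, Prop. 5.3 p.103] -/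
@[simp] theorem degFr_toModel_map {X Y : FrakRlfCat F} (φ : X ⟶ Y) :
    ModelFrobenioid.degFr ((toModel F).map φ) = deg φ := rfl

/-- `toModel` sends `(n, u)` to the unit `u ∈ ℝ · Φ^birat`. [cite: MochizukiFrdI2008, Prop. 5.3 p.103] -/
@[simp] theorem unit_toModel_map {X Y : FrakRlfCat F} (φ : X ⟶ Y) :
    ModelFrobenioid.unit ((toModel F).map φ) = homUnit φ := rfl

/-- `toModel` sends `(n, u)` to the zero divisor `u + n•𝔍₁ − 𝔍₂`. [cite: MochizukiFrdI2008, Prop. 5.3 p.103] -/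
theorem div_toModel_map {X Y : FrakRlfCat F} (φ : X ⟶ Y) :
    ModelFrobenioid.div ((toModel F).map φ) = homDiv φ := rfl

/-! ### `toModel` is an equivalence of categories -/

/-- Relation (d) of a morphism of the model Frobenioid between objects in the image of `toModel` says exactly
that its zero divisor is the family `u + n•𝔍₁ − 𝔍₂` of its unit `u`. [cite: MochizukiFrdI2008, Thm. 5.2 (i) p.100] -/
theorem coe_div_eq_of_hom {X Y : FrakRlfCat F} (ψ : (toModel F).obj X ⟶ (toModel F).obj Y) :
    (Multiplicative.toAdd
        (ModelFrobenioid.div ψ : EffDiv (ModelPlaces F) (fun _ => ℝ) nonnegModel)).1 =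
      ((Multiplicative.toAdd (ModelFrobenioid.unit ψ : Multiplicative (realRatFn F)) : realRatFn F) :
          ModelFrakObj F) +
        (ModelFrobenioid.degFr ψ : ℕ) • X.obj - Y.obj := by
  change (⟨pt, objCls F X⟩ : RlfModel F) ⟶ ⟨pt, objCls F Y⟩ at ψ
  have hb : ModelFrobenioid.baseMap ψ = 𝟙 pt := Subsingleton.elim _ _
  have hrel := ModelFrobenioid.rel ψ
  rw [hb, pullGp_id, divB_divBRlf, divBRlfHom_apply] at hrel
  change objCls F X ^ (ModelFrobenioid.degFr ψ : ℕ) *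
      Algebra.GrothendieckGroup.of (M := EffDiv (ModelPlaces F) (fun _ => ℝ) nonnegModel) (ModelFrobenioid.div ψ) =
    objCls F Y * _ at hrel
  have hd : Algebra.GrothendieckGroup.of (M := EffDiv (ModelPlaces F) (fun _ => ℝ) nonnegModel)
        (ModelFrobenioid.div ψ) =
      toGp (modelHyps_places F) (Multiplicative.ofAdd
        (Multiplicative.toAdd (ModelFrobenioid.div ψ : EffDiv (ModelPlaces F) (fun _ => ℝ) nonnegModel)).1) := by
    rw [toGp_ofAdd, toGpFun_of_mem (modelHyps_places F)
      (Multiplicative.toAdd (ModelFrobenioid.div ψ : EffDiv (ModelPlaces F) (fun _ => ℝ) nonnegModel)).2]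
    rfl
  rw [hd] at hrel
  unfold objCls at hrel
  rw [← map_pow, ← map_mul, ← map_mul] at hrel
  have h := congrArg Multiplicative.toAdd (toGp_injective (modelHyps_places F) hrel)
  simp only [toAdd_mul, toAdd_pow, toAdd_ofAdd, smul_neg] at h
  -- `h : -(n • X.obj) + Div = -Y.obj + u`
  set Dv := (Multiplicative.toAdd
    (ModelFrobenioid.div ψ : EffDiv (ModelPlaces F) (fun _ => ℝ) nonnegModel)).1 with hDv
  set u := ((Multiplicative.toAdd (ModelFrobenioid.unit ψ : Multiplicative (realRatFn F)) : realRatFn F) :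
    ModelFrakObj F) with hu
  calc Dv = (ModelFrobenioid.degFr ψ : ℕ) • X.obj + (-((ModelFrobenioid.degFr ψ : ℕ) • X.obj) + Dv) := by abel
    _ = (ModelFrobenioid.degFr ψ : ℕ) • X.obj + (-Y.obj + u) := by rw [h]
    _ = _ := by abel

variable (F) in
/-- `toModel` is FULL: a morphism `(n, 𝟙, Div, u)` of the model Frobenioid between `(∗, −[𝔍₁])` and `(∗, −[𝔍₂])` is
the image of the morphism `(n, u)` of `(†𝓕⊛ℝ_𝔪𝔬𝔡)_α` (relation (d) is the effectivity of `u + n•𝔍₁ − 𝔍₂`).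
[cite: MochizukiFrdI2008, Prop. 5.3 p.103] -/
theorem toModel_full : (toModel F).Full where
  map_surjective {X Y} ψ := by
    have hcoe := coe_div_eq_of_hom ψ
    have heff : ((Multiplicative.toAdd (ModelFrobenioid.unit ψ : Multiplicative (realRatFn F)) : realRatFn F) :
          ModelFrakObj F) + (ModelFrobenioid.degFr ψ : ℕ) • X.obj - Y.obj ∈
        effDiv (ModelPlaces F) (fun _ => ℝ) nonnegModel := by
      rw [← hcoe]
      exact (Multiplicative.toAdd (ModelFrobenioid.div ψ : EffDiv (ModelPlaces F) (fun _ => ℝ) nonnegModel)).2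
    refine ⟨homMk (ModelFrobenioid.degFr ψ) _
      (Multiplicative.toAdd (ModelFrobenioid.unit ψ : Multiplicative (realRatFn F))).2 heff,
      ModelFrobenioid.Hom.ext rfl (Subsingleton.elim _ _) ?_ rfl⟩
    show homDiv _ = (ModelFrobenioid.div ψ : EffDiv (ModelPlaces F) (fun _ => ℝ) nonnegModel)
    apply Multiplicative.toAdd.injective
    apply Subtype.ext
    exact hcoe.symm

variable (F) in
/-- `toModel` is FAITHFUL: `(n, u)` is recovered as (Frobenius degree, unit). [cite: MochizukiFrdI2008, Prop. 5.3 p.103] -/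
theorem toModel_faithful : (toModel F).Faithful where
  map_injective {_ _} := fun _ _ h =>
    hom_ext (congrArg ModelFrobenioid.Hom.degFr h)
      (congrArg (fun k : Multiplicative (realRatFn F) => ((Multiplicative.toAdd k : realRatFn F) : ModelFrakObj F))
        (congrArg ModelFrobenioid.Hom.unit h))

variable (F) in
/-- `toModel` is ESSENTIALLY SURJECTIVE: every class in `(Φ^rlf)^gp = ⊕'_v ℝ` is `−[𝔍]` for a real family `𝔍`.
[cite: MochizukiFrdI2008, Prop. 5.3 p.103] -/
theorem toModel_essSurj : (toModel F).EssSurj where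
  mem_essImage M := by
    obtain ⟨b, c⟩ := M
    obtain ⟨⟨⟩⟩ := b
    obtain ⟨y, hy⟩ := toGp_surjective (modelHyps_places F) c
    refine ⟨of (-(Multiplicative.toAdd y)), ⟨eqToIso ?_⟩⟩
    show (⟨pt, objCls F (of (-(Multiplicative.toAdd y)))⟩ : RlfModel F) = ⟨pt, c⟩
    congr 1
    unfold objCls
    rw [obj_of, neg_neg]
    exact hy

variable (F) in
/-- **`(†𝓕⊛ℝ_𝔪𝔬𝔡)_α ≌ ModelFrobenioid(𝒟, Φ^rlf, ℝ · Φ^birat)`** — [FrdI] Prop. 5.3 at the model of record: the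
realification IS (equivalent, by the comparison functor, to) "the model Frobenioid associated to the divisor monoid
`Φ^rlf` and the rational function monoid `ℝ · Φ^birat`". [cite: MochizukiFrdI2008, Prop. 5.3 p.103] -/
instance toModel_isEquivalence : (toModel F).IsEquivalence :=
  haveI := toModel_full F
  haveI := toModel_faithful F
  haveI := toModel_essSurj F
  { }

/-! ### The Frobenioid structure `(†𝓕⊛ℝ_𝔪𝔬𝔡)_α → F_{Φ^rlf}` and [FrdI] Thm. 5.2 (ii) -/

variable (F) in
/-- **The Frobenioid structure of the realification**: the functor `(†𝓕⊛ℝ_𝔪𝔬𝔡)_α → F_{Φ^rlf}`, `𝔍 ↦ ∗`,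
`(n, u) ↦ (id_∗, u + n•𝔍₁ − 𝔍₂, n)`, obtained through the model Frobenioid ([FrdI] Thm. 5.2 (i): "the Frobenius
degree, projection to `𝒟`, and zero divisor determine a functor `C → F_Φ`"). [cite: MochizukiFrdI2008, Thm. 5.2 (i) p.100] -/
def structureFunctor : FrakRlfCat F ⥤ ElemFrobenioid (PhiRlf F) :=
  toModel F ⋙ ModelFrobenioid.toElem (PhiRlf F) (BRlf F) (divBRlf F)

/-- The hypotheses of [FrdI] Thm. 5.2 (ii) for `Φ^rlf`: objectwise divisorial (abc-iut-L6-t6's `isDivisorial_effDiv`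
at abc-iut-L6-d1's `modelHyps_places`: `ℝ_{≥0} ⊆ ℝ` is generating, saturated, sharp). [cite: MochizukiFrdI2008, Thm. 5.2 (ii) p.101] -/
theorem objectwise_isDivisorial_PhiRlf : Objectwise (fun M _ => IsDivisorial M) (PhiRlf F) :=
  objectwise_isDivisorial_Φmod (modelHyps_places F)

/-- Every object of the realification lies over the unique object `∗` of the one-arrow base.
[cite: MochizukiFrdI2008, Prop. 5.3 p.103] -/
theorem baseObj_eq (X : FrakRlfCat F) : PreFrobenioid.baseObj (structureFunctor F) X = pt := rfl

/-- The Frobenius degree of `(n, u)` in the Frobenioid structure is `n`. [cite: MochizukiFrdI2008, Thm. 5.2 (i) p.100] -/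
theorem degFr_eq_deg {X Y : FrakRlfCat F} (φ : X ⟶ Y) :
    PreFrobenioid.degFr (structureFunctor F) φ = deg φ := rfl

/-- The zero divisor of `(n, u) : 𝔍₁ → 𝔍₂` in the Frobenioid structure is the effective family `u + n•𝔍₁ − 𝔍₂`.
[cite: MochizukiFrdI2008, Thm. 5.2 (i) p.100] -/
theorem div_eq_homDiv {X Y : FrakRlfCat F} (φ : X ⟶ Y) :
    PreFrobenioid.Div (structureFunctor F) φ = homDiv φ := rfl

/-- A morphism `(n, u)` of the realification is LINEAR ([FrdI] Def. 1.2 (i)) iff `n = 1`.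
[cite: MochizukiFrdI2008, Def. 1.2 (i) p.22] -/
theorem isLinear_iff_deg_eq_one {X Y : FrakRlfCat F} (φ : X ⟶ Y) :
    PreFrobenioid.IsLinear (structureFunctor F) φ ↔ deg φ = 1 := Iff.rfl

variable (F) in
/-- **`(†𝓕⊛ℝ_𝔪𝔬𝔡)_α` IS A FROBENIOID** ([FrdI] Def. 1.3 (i)–(vii), abc-iut-found's `PreFrobenioid.IsFrobenioid`): by
[FrdI] Thm. 5.2 (ii) for the model Frobenioid of `(𝒟, Φ^rlf, ℝ · Φ^birat)` (`Φ^rlf` divisorial, `ℝ · Φ^birat`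
group-like, `𝒟` connected and totally epimorphic — abc-iut-found's `ModelFrobenioid.isFrobenioid`) transported along the
equivalence `toModel`. This is the sense in which [IUTchIII] Prop. 3.7 (iii)'s "one obtains a [global realified]
Frobenioid" holds at the model of record for the realification of `(†𝓕⊛_𝔪𝔬𝔡)_α`. [cite: MochizukiFrdI2008, Thm. 5.2 (ii) p.101] -/
theorem isFrobenioid : PreFrobenioid.IsFrobenioid (structureFunctor F) :=
  PreFrobenioid.IsFrobenioid.comp_of_isEquivalence (toModel F)
    (ModelFrobenioid.isFrobenioid (isMonoidOn_constMonoidOn _) (objectwise_isDivisorial_PhiRlf (F := F))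
      (isMonoidOn_constMonoidOn _) (objectwise_isGroupLike_BRlf F) isGraphConnected_base
      isTotallyEpimorphic_base)

variable (F) in
/-- The Frobenioid `(†𝓕⊛ℝ_𝔪𝔬𝔡)_α` is of ISOTROPIC type ([FrdI] Thm. 5.2 (ii)). [cite: MochizukiFrdI2008, Thm. 5.2 (ii) p.101] -/
theorem isOfIsotropicType : PreFrobenioid.IsOfIsotropicType (structureFunctor F) :=
  PreFrobenioid.isOfIsotropicType_comp_equivalence (toModel F).asEquivalence
    (ModelFrobenioid.isOfIsotropicType (objectwise_isGroupLike_BRlf F))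

variable (F) in
/-- In particular `(†𝓕⊛ℝ_𝔪𝔬𝔡)_α → F_{Φ^rlf}` is a pre-Frobenioid ([FrdI] Def. 1.1 (iv)).
[cite: MochizukiFrdI2008, Def. 1.1 (iv) p.19] -/
theorem isPreFrobenioid : IsPreFrobenioid (PhiRlf F) (structureFunctor F) :=
  (isFrobenioid F).isPreFrobenioid

end FrakRlfCat

end Prop37

end Literature.IUT.LogThetaLattice

end
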